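import Summits.NavierStokesRegularity.FluidComputer.GateBudgetPulseCeiling
import HarnessLib

/-!
# GateBudget part 76 — the leak ceiling of one pulse, III: the two-sided rung (§227)

Cell `pub-fluidc`, blueprint seat bp1 (gen 36, third item, file 4 of 4); namespace
`Summit.NavierStokesRegularity.FluidComputer.GateBudget`, headline family
`RotorKnob.rotorCircuit K K¹⁰ ε ρ` from `delayInit` (`K ≥ 16`, window
`200ε/K²⁰ ≤ ρ² ≤ 2ε/K¹⁰`, `ε² ≤ 1/(6K²⁰)`, lattice `ε = kK¹⁰ρ²`). HONEST FRAMING: a low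
prior, high value-of-information experiment on Tao's machine paradigm; NOT a claim that NS
blows up.

§227 `knob_rung_two_sided`: at a normal-form ignition — `b(r) = θε` with `5/4 ≤ θ ≤ 3/2`,
`c(r) = ρ²/K⁹`, `P(r) = d(r)² + ã(r)² ≤ 1/50` — the fine pulse of part 65 §203 ends at some
`T' ∈ (r, r + 242/K⁹]`, `T' - r ≤ 241 log K/K¹⁰`, and its leak is TWO-SIDED:
`ã(r) + 1/K⁹ ≤ ã(T') ≤ ã(r) + (7/2 + k²/3 + (2 log k + 520 log K)·d(r)²)/K⁹`.
The floor is part 71 §217 at the part-52 pin `δ₀ = kπ/((25/16 - 10⁻⁶)K¹⁰ - 1) + 1/K¹⁹`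
(exactly as part 72 §218, but for the fine pulse); the ceiling is part 75 §226 at the same pin,
whose contribution `1500δ₀²log K ≤ 24000k²/K¹⁹ ≤ k²/12` is absorbed (`δ₀ ≤ 4k/K¹⁰`,
`log K ≤ K`).

WHAT THIS SAYS (and does not). Per clean rung (`k = 1`, `d(r)² ≤ 1/50`):
`1/K⁹ ≤ Δã ≤ (3.84 + 10.4 log K)/K⁹`, and `≤ 3.84/K⁹ + 520 d(r)² log K/K⁹` in general — the
remaining `log K` is carried ONLY by the entry pair coordinate `d(r)²`, so a d-ledger (how
small `d` is at clean ignitions, from the cold-phase damping `d' = ρ⁻²ca - Kdã`) is exactly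
what separates the programme from a two-sided `Θ(K⁹)` clean dud horizon; it is NOT supplied
here. Nothing about Navier–Stokes.
[cite: Tao2016AveragedNS, §5.5 Theorem 5.3, (5.5), (b-eq), (c-eq), (d-eq), (energy-con)]
-/

noncomputable section

namespace Summit.NavierStokesRegularity.FluidComputer.GateBudget

open Real Set Filter Topology
open Literature.Analysis.FluidPDE.Tao2016AveragedNS

variable {K ε ρ : ℝ} {X : ℝ → Fin 5 → ℝ} {C : ℝ → ℝ}

/-! ## §227 The two-sided rung -/

/-- §227 THE TWO-SIDED RUNG (headline member, `K ≥ 16`, `200ε/K²⁰ ≤ ρ² ≤ 2ε/K¹⁰`,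
`ε² ≤ 1/(6K²⁰)`, lattice `ε = kK¹⁰ρ²`). At a normal-form ignition (`b(r) = θε`,
`5/4 ≤ θ ≤ 3/2`, `c(r) = ρ²/K⁹`, `d(r)² + ã(r)² ≤ 1/50`, `r ≥ 0`) there is an exit time
`T'`, `r < T' ≤ r + 242/K⁹`, `T' - r ≤ 241 log K/K¹⁰`, with
`ã(r) + 1/K⁹ ≤ ã(T') ≤ ã(r) + (7/2 + k²/3 + (2 log k + 520 log K)·d(r)²)/K⁹`.
[derived: part 65 §203, part 52 §153/§154, part 71 §217, part 75 §226, this file] -/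
theorem knob_rung_two_sided
    (hX : ∀ t, HasDerivAt X (RotorKnob.rotorCircuit K (K ^ 10) ε ρ (X t)) t)
    (h0 : X 0 = delayInit) (hC : ∀ t, HasDerivAt C (X t 2) t) (hK : 16 ≤ K) (hε : 0 < ε)
    (hεK : ε ^ 2 ≤ 1 / (6 * K ^ 20)) (hρ : 0 < ρ) (hlo : 200 * ε / K ^ 20 ≤ ρ ^ 2)
    (hhi : K ^ 10 * ρ ^ 2 ≤ 2 * ε) (k : ℕ) (hk : ε = k * K ^ 10 * ρ ^ 2) {r θ : ℝ}
    (hr : 0 ≤ r) (hθ1 : 5 / 4 ≤ θ) (hθ2 : θ ≤ 3 / 2) (hbr : X r 1 = θ * ε)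
    (hcr : X r 2 = ρ ^ 2 / K ^ 9) (hPr : X r 3 ^ 2 + X r 4 ^ 2 ≤ 1 / 50) :
    ∃ T' : ℝ, r < T' ∧ T' - r ≤ 242 / K ^ 9 ∧ T' - r ≤ 241 * log K / K ^ 10 ∧
      X r 4 + 1 / K ^ 9 ≤ X T' 4 ∧
      X T' 4 ≤ X r 4 + (7 / 2 + k ^ 2 / 3 + (2 * log k + 520 * log K) * X r 3 ^ 2) / K ^ 9 := by
  have hK0 : (0 : ℝ) < K := by linarith
  have hK1 : (1 : ℝ) ≤ K := by linarith
  obtain ⟨hk1, -, -, hδ0, hδ, h243⟩ := leak_numerics hK hε hρ hlo k hk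
  -- (1) the fine pulse (part 65 §203)
  obtain ⟨T', θ₁, hrT, hτ, hτf, hcpos, hcT1, -, -, hbT, hθ₁lo, -, hkept, hgrow⟩ :=
    knob_pulse_exit_fine hX h0 hK hε hρ hlo hhi hr hθ1 hθ2 hbr hcr
  have hθ₁1 : 1 ≤ θ₁ := by linarith only [hθ₁lo, hθ1, h243]
  -- (2) the ring and the pin (part 52 §153/§154), uniform `ν₂ = 25/16 - 10⁻⁶`
  have hbr' : 5 / 4 * ε ≤ X r 1 := by rw [hbr]; nlinarith only [hθ1, hε]
  have hring := kept_ring hε.le (by norm_num : (0 : ℝ) ≤ 5 / 4) hbr' hkept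
  have hring' : ∀ t ∈ Icc r T', (25 / 16 - 1 / 10 ^ 6) * ε ^ 2 ≤ X t 1 ^ 2 + X t 2 ^ 2 := by
    intro t ht
    have := hring t ht
    linarith only [this]
  have hbT1 : X T' 1 ≤ -(1 * ε) := by rw [hbT]; nlinarith only [hθ₁1, hε]
  obtain ⟨hpin, -, -, -, -⟩ := knob_pulse_step hX h0 hC hK hε hεK hρ hhi k hk hr
    hrT.le hτ (le_refl _) (le_refl _) (by norm_num) hcpos hcr.le hbr' hbT1 hcT1 hring' hgrow
  obtain ⟨δ, hδ_def⟩ :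
      ∃ δ : ℝ, δ = k * π / ((25 / 16 - 1 / 10 ^ 6) * K ^ 10 - 1) + 1 / K ^ 19 := ⟨_, rfl⟩
  simp only [← hδ_def] at hδ0 hδ hpin
  -- (3) the entry radius `b(r)² + c(r)² ≤ (θ² + 10⁻⁶)ε²`
  have hK10 : (2 : ℝ) ^ 40 ≤ K ^ 10 := by
    calc (2 : ℝ) ^ 40 = 16 ^ 10 := by norm_num
      _ ≤ K ^ 10 := pow_le_pow_left₀ (by norm_num) hK 10
  have hK10pos : (0 : ℝ) < K ^ 10 := by positivity
  have hK9pos : (0 : ℝ) < K ^ 9 := by positivity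
  have hρε : ρ ^ 2 ≤ 2 * ε / K ^ 10 := by
    rw [le_div_iff₀ hK10pos]
    linarith only [hhi]
  have hc1 : ρ ^ 2 / K ^ 9 ≤ ε / 10 ^ 3 := by
    have e1 : ρ ^ 2 / K ^ 9 ≤ ρ ^ 2 :=
      div_le_self (by positivity) (one_le_pow₀ (by linarith only [hK]))
    have e3 : 2 * ε / K ^ 10 ≤ 2 * ε / 2 ^ 40 :=
      div_le_div_of_nonneg_left (by positivity) (by positivity) hK10
    have e4 : 2 * ε / 2 ^ 40 ≤ ε / 10 ^ 3 := by
      rw [div_le_div_iff₀ (by positivity) (by positivity)]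
      linarith only [hε]
    linarith only [e1, hρε, e3, e4]
  have hc2 : (ρ ^ 2 / K ^ 9) ^ 2 ≤ ε ^ 2 / 10 ^ 6 := by
    calc (ρ ^ 2 / K ^ 9) ^ 2 ≤ (ε / 10 ^ 3) ^ 2 := pow_le_pow_left₀ (by positivity) hc1 2
      _ = ε ^ 2 / 10 ^ 6 := by rw [div_pow]; norm_num
  have hbc : X r 1 ^ 2 + X r 2 ^ 2 ≤ (θ ^ 2 + 1 / 10 ^ 6) * ε ^ 2 := by
    rw [hbr, hcr]
    nlinarith only [hc2]
  -- (4) the leak law of §217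
  have hleak := knob_pulse_leak hX h0 hC hK hε hεK hρ hhi k hk hr hrT.le hτ
    (by linarith only [hθ1]) hbc hkept hpin
  -- (5) the entry carrier `a(r)² + d(r)² ≥ 49/50 - 10⁻⁶` and the numerics
  have hbc' : X r 1 ^ 2 + X r 2 ^ 2 ≤ 1 / 10 ^ 6 := by
    refine hbc.trans ?_
    have e1 : (θ ^ 2 + 1 / 10 ^ 6) * ε ^ 2 ≤ (9 / 4 + 1 / 10 ^ 6) * ε ^ 2 :=
      mul_le_mul_of_nonneg_right (by nlinarith only [hθ1, hθ2]) (sq_nonneg ε)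
    have hK20 : (2 : ℝ) ^ 80 ≤ K ^ 20 := by
      calc (2 : ℝ) ^ 80 = 16 ^ 20 := by norm_num
        _ ≤ K ^ 20 := pow_le_pow_left₀ (by norm_num) hK 20
    have e2 : ε ^ 2 ≤ 1 / (6 * 2 ^ 40) :=
      hεK.trans (div_le_div_of_nonneg_left (by norm_num) (by positivity)
        (by linarith only [hK20]))
    nlinarith only [e1, e2]
  have hA : 49 / 50 - 1 / 10 ^ 6 ≤ X r 0 ^ 2 + X r 3 ^ 2 := by
    have hE := RotorKnob.traj_sum_sq_eq_one hX h0 r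
    nlinarith only [hE, hbc', hPr, sq_nonneg (X r 3)]
  have hnum : 1 / K ^ 9 ≤ ((X r 0 ^ 2 + X r 3 ^ 2) * π / 2 - δ - δ ^ 2) / ((θ + 1 / 500) * K ^ 9)
      - 1 / (600 * K ^ 9) := by
    have hpos : 0 < (θ + 1 / 500) * K ^ 9 := by positivity
    have hAπ : (49 / 50 - 1 / 10 ^ 6) * 3.14 ≤ (X r 0 ^ 2 + X r 3 ^ 2) * π :=
      mul_le_mul hA Real.pi_gt_d2.le (by norm_num) (by positivity)
    have hδ2 : δ ^ 2 ≤ δ * (1 / 80) := by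
      rw [sq]
      exact mul_le_mul_of_nonneg_left hδ hδ0
    have key : (1 + 1 / 600) * (θ + 1 / 500)
        ≤ (X r 0 ^ 2 + X r 3 ^ 2) * π / 2 - δ - δ ^ 2 := by
      nlinarith only [hAπ, hδ2, hδ, hδ0, hθ2, hθ1]
    have e1 : (1 + 1 / 600) / K ^ 9 = (1 + 1 / 600) * (θ + 1 / 500) / ((θ + 1 / 500) * K ^ 9) := by
      rw [div_eq_div_iff hK9pos.ne' hpos.ne']
      ring
    have e2 := div_le_div_of_nonneg_right key hpos.le
    rw [← e1] at e2
    have e3 : 1 / K ^ 9 = (1 + 1 / 600) / K ^ 9 - 1 / (600 * K ^ 9) := by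
      rw [eq_sub_iff_add_eq, div_add_div _ _ hK9pos.ne' (by positivity),
        div_eq_div_iff (by positivity) hK9pos.ne']
      ring
    rw [e3]
    linarith only [e2]
  -- (6) the ceiling (part 75 §226) at the same pin
  have hbT' : X T' 1 ≤ -(31 / 32 * θ * ε) := by
    rw [hbT]
    have : 31 / 32 * θ ≤ θ₁ := by linarith only [hθ₁lo, hθ1, h243]
    nlinarith only [this, hε]
  have hceil := knob_pulse_ceiling hX h0 hC hK hε hρ hlo hhi k hk hr hrT.le hτ hτf hθ1 hθ2
    hbr hcr hkept hcpos hbT' hpin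
  -- (7) the pin term is tiny: `δ ≤ 4k/K¹⁰`, `1500δ²log K ≤ k²/12`
  have hK10 : (0 : ℝ) < K ^ 10 := by positivity
  have h1610 : (16 : ℝ) ^ 10 ≤ K ^ 10 := pow_le_pow_left₀ (by norm_num) hK 10
  have hδk : δ ≤ 4 * k / K ^ 10 := by
    rw [hδ_def]
    have e1 : k * π / ((25 / 16 - 1 / 10 ^ 6) * K ^ 10 - 1) ≤ k * π / (3 / 2 * K ^ 10) :=
      div_le_div_of_nonneg_left (by positivity) (by positivity) (by nlinarith only [h1610])
    have e2 : k * π / (3 / 2 * K ^ 10) ≤ 3 * k / K ^ 10 := by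
      rw [div_le_div_iff₀ (by positivity) hK10]
      have hkK : (0 : ℝ) ≤ k * K ^ 10 := by positivity
      nlinarith only [mul_nonneg hkK (sub_nonneg.2 pi_le_four), hkK]
    have e3 : 1 / K ^ 19 ≤ k / K ^ 10 := by
      calc 1 / K ^ 19 ≤ 1 / K ^ 10 := div_le_div_of_nonneg_left zero_le_one hK10
              (pow_le_pow_right₀ hK1 (by norm_num))
        _ ≤ k / K ^ 10 := div_le_div_of_nonneg_right hk1 hK10.le
    have e4 : 3 * (k : ℝ) / K ^ 10 + k / K ^ 10 = 4 * k / K ^ 10 := by ring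
    linarith only [e1, e2, e3, e4]
  have hlogK : 0 ≤ log K := log_nonneg hK1
  have hpinterm : 1500 * δ ^ 2 * log K ≤ k ^ 2 / 12 := by
    have e1 : δ ^ 2 ≤ (4 * k / K ^ 10) ^ 2 := pow_le_pow_left₀ hδ0 hδk 2
    have e2 : log K ≤ K := (log_le_sub_one_of_pos hK0).trans (by linarith)
    have e3 : 1500 * δ ^ 2 * log K ≤ 1500 * (4 * k / K ^ 10) ^ 2 * K :=
      mul_le_mul (mul_le_mul_of_nonneg_left e1 (by norm_num)) e2 hlogK (by positivity)
    refine e3.trans ?_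
    rw [show 1500 * (4 * (k : ℝ) / K ^ 10) ^ 2 * K = 24000 * k ^ 2 * K / (K ^ 10 * K ^ 10) by
        field_simp; ring, div_le_div_iff₀ (by positivity) (by norm_num)]
    have h19 : (16 : ℝ) ^ 19 ≤ K ^ 19 := pow_le_pow_left₀ (by norm_num) hK 19
    nlinarith only [mul_le_mul_of_nonneg_left h19 (mul_nonneg hK0.le (sq_nonneg (k : ℝ))),
      sq_nonneg (k : ℝ), hK0]
  refine ⟨T', hrT, hτ, hτf, by linarith only [hleak, hnum], ?_⟩
  have hK9 : (0 : ℝ) < K ^ 9 := by positivity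
  have e : (7 / 2 + k ^ 2 / 4 + 2 * X r 3 ^ 2 * log k + (520 * X r 3 ^ 2 + 1500 * δ ^ 2) * log K)
      / K ^ 9 ≤ (7 / 2 + k ^ 2 / 3 + (2 * log k + 520 * log K) * X r 3 ^ 2) / K ^ 9 :=
    div_le_div_of_nonneg_right (by nlinarith only [hpinterm]) hK9.le
  linarith only [hceil, e]

end Summit.NavierStokesRegularity.FluidComputer.GateBudget
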